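import Summits.KontsevichZagierPeriods.KontsevichZagierPeriods.Theorems.SoloBlindCauchyIntegrable
import Summits.KontsevichZagierPeriods.KontsevichZagierPeriods.Theorems.SoloBlindDilogPieces
import HarnessLib

/-!
# Cauchy's theorem inside the rules, IV: the chart of the first Green route

Data for integrating `h = -∂Q/∂x` first in `x` over the fibres of `D = {x < ½, y > 0}`: the
compactifying coordinate `m(u) = u/(1-u)`, the rational chart `Φ_B(y,u) = (½ - m(u), y)` of `D`
by the band `(0,∞) × (0,1)` with its Jacobian `1/(1-u)²`, the transported integrand `fB` and the
fibre primitive `FB = Q ∘ Φ_B` (both `ℚ`-semialgebraic on the closed band, extended by `0` to the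
edge `u = 1`), absolute integrability of `fB`, and an elementary continuity lemma at a
compactified end.  The moves themselves are made in `SoloBlindCauchyStokesB`.

References: Kontsevich–Zagier, *Periods* (2001), §1.2.
-/

noncomputable section

namespace Summit.KontsevichZagierPeriods.KontsevichZagierPeriods.Theorems

open Set Complex MeasureTheory Filter
open Literature.ModelTheory.ExponentialFields (IsSemialgebraic isSemialgebraic_setOf_eval_pos
  isSemialgebraic_setOf_eval_nonneg)
open MvPolynomial (aeval X)
open Literature.NumberTheory.Transcendental
open Literature.NumberTheory.Transcendental.KZ

namespace SoloBlind

/-! ## The compactifying coordinate `m(t) = t/(1-t)` -/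

/-- `m(t) = t/(1-t)`, a rational bijection `(0,1) → (0,∞)`. -/
def moeb (t : ℝ) : ℝ := t / (1 - t)

/-- `m(0) = 0`. -/
@[simp] theorem moeb_zero : moeb 0 = 0 := by simp [moeb]

/-- `m'(t) = 1/(1-t)²` (`t ≠ 1`). -/
theorem hasDerivAt_moeb {t : ℝ} (ht : t ≠ 1) : HasDerivAt moeb (1 / (1 - t) ^ 2) t := by
  have h1 : (1 : ℝ) - t ≠ 0 := sub_ne_zero.mpr (Ne.symm ht)
  have h := (hasDerivAt_id t).div ((hasDerivAt_id t).const_sub 1) h1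
  simp only [id, one_mul, mul_neg, mul_one, sub_neg_eq_add, sub_add_cancel] at h
  exact h

/-- `m > 0` on `(0,1)`. -/
theorem moeb_pos {t : ℝ} (h0 : 0 < t) (h1 : t < 1) : 0 < moeb t := div_pos h0 (by linarith)

/-- `m ≥ 0` on `[0,1)`. -/
theorem moeb_nonneg {t : ℝ} (h0 : 0 ≤ t) (h1 : t < 1) : 0 ≤ moeb t := div_nonneg h0 (by linarith)

/-- The inverse: `m(y/(1+y)) = y`. -/
theorem moeb_div_one_add {y : ℝ} (hy : 0 ≤ y) : moeb (y / (1 + y)) = y := by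
  have h1 : (1 : ℝ) + y ≠ 0 := by positivity
  rw [moeb]
  field_simp
  ring

/-- `m` is injective on `(-∞, 1)`. -/
theorem injOn_moeb : InjOn moeb (Iio 1) := by
  intro s hs t ht h
  have hs' : (1 : ℝ) - s ≠ 0 := by have := hs.out; intro h0; linarith
  have ht' : (1 : ℝ) - t ≠ 0 := by have := ht.out; intro h0; linarith
  simp only [moeb] at h
  rw [div_eq_div_iff hs' ht'] at h
  nlinarith [h]

/-- `m((0,1)) = (0,∞)`. -/
theorem image_moeb : moeb '' Ioo 0 1 = Ioi 0 := by
  ext y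
  constructor
  · rintro ⟨t, ht, rfl⟩
    exact moeb_pos ht.1 ht.2
  · intro hy
    have hy' : (0 : ℝ) < y := hy
    exact ⟨y / (1 + y), ⟨div_pos hy' (by linarith), (div_lt_one (by linarith)).mpr (by linarith)⟩,
      moeb_div_one_add hy'.le⟩

/-- **Continuity at the compactified end.** A function continuous on `[0,1)`, vanishing at `1`
and `O(1-t)` on some `[c,1)` is continuous on `[0,1]`. -/
theorem continuousOn_Icc_of_decay {G : ℝ → ℝ} {c C : ℝ} (hc : c < 1)
    (hG : ContinuousOn G (Ico 0 1)) (h1 : G 1 = 0) (hdec : ∀ t ∈ Ico c 1, |G t| ≤ C * (1 - t)) :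
    ContinuousOn G (Icc 0 1) := by
  intro t ht
  rcases ht.2.lt_or_eq with hlt | rfl
  · refine (hG t ⟨ht.1, hlt⟩).mono_of_mem_nhdsWithin ?_
    exact mem_nhdsWithin.mpr ⟨Iio 1, isOpen_Iio, hlt, fun s ⟨hs1, hs2⟩ => ⟨hs2.1, hs1⟩⟩
  · rw [Metric.continuousWithinAt_iff]
    intro ε hε
    refine ⟨min (1 - c) (ε / (|C| + 1)), lt_min (by linarith) (by positivity), ?_⟩
    intro s hs hds
    rw [Real.dist_eq, h1, sub_zero]
    rcases hs.2.lt_or_eq with hs1 | rfl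
    · rw [Real.dist_eq, abs_sub_comm, abs_of_pos (by linarith)] at hds
      have hsc : c ≤ s := by have := lt_of_lt_of_le hds (min_le_left _ _); linarith
      have hsε : 1 - s < ε / (|C| + 1) := lt_of_lt_of_le hds (min_le_right _ _)
      have hC1 : 0 < |C| + 1 := by positivity
      calc |G s| ≤ C * (1 - s) := hdec s ⟨hsc, hs1⟩
        _ ≤ (|C| + 1) * (1 - s) := by nlinarith [le_abs_self C, hs1]
        _ < (|C| + 1) * (ε / (|C| + 1)) := by gcongr
        _ = ε := by field_simp
    · simpa [h1] using hε

/-- **Decay at a compactified end.** If `q ≥ 1/(4(1-t)²)` with `4(1-t)² ≤ 1`, then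
`q^e ≤ 2(1-t)` for exponents `e ≤ 0` with `-e ≥ 1/2`. -/
theorem rpow_le_two_mul_one_sub {e q t : ℝ} (he0 : e ≤ 0) (he2 : 1 / 2 ≤ -e) (ht : t < 1)
    (hb1 : 4 * (1 - t) ^ 2 ≤ 1) (hsq : 1 / (4 * (1 - t) ^ 2) ≤ q) : q ^ e ≤ 2 * (1 - t) := by
  have h1t : 0 < 1 - t := by linarith
  have hb : 0 < 4 * (1 - t) ^ 2 := by positivity
  calc q ^ e ≤ (1 / (4 * (1 - t) ^ 2)) ^ e := Real.rpow_le_rpow_of_nonpos (by positivity) hsq he0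
    _ = (4 * (1 - t) ^ 2) ^ (-e) := by
        rw [one_div, Real.inv_rpow hb.le, ← Real.rpow_neg hb.le]
    _ ≤ (4 * (1 - t) ^ 2) ^ (1 / 2 : ℝ) := Real.rpow_le_rpow_of_exponent_ge hb hb1 he2
    _ = 2 * (1 - t) := by
        rw [← Real.sqrt_eq_rpow, show (4 : ℝ) * (1 - t) ^ 2 = (2 * (1 - t)) ^ 2 by ring,
          Real.sqrt_sq (by linarith)]

/-! ## The chart `Φ_B(y,u) = (½ - m(u), y)` -/

/-- `Φ_B(w) = (½ - m(w 1), w 0)`: source `w 0 = y`, `w 1 = u`; target `(x, y)`. -/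
def chartB (w : Fin 2 → ℝ) : Fin 2 → ℝ := ![1 / 2 - moeb (w 1), w 0]

/-- `DΦ_B(w)`. -/
def chartBDeriv (w : Fin 2 → ℝ) : (Fin 2 → ℝ) →L[ℝ] (Fin 2 → ℝ) :=
  ContinuousLinearMap.pi ![(-(1 / (1 - w 1) ^ 2)) • pr2 1, pr2 0]

/-- `Φ_B` has derivative `DΦ_B` off `u = 1`. -/
theorem hasFDerivAt_chartB {w : Fin 2 → ℝ} (hw : w 1 ≠ 1) :
    HasFDerivAt chartB (chartBDeriv w) w := by
  have hπ0 : HasFDerivAt (fun q : Fin 2 → ℝ => q 0) (pr2 0) w := hasFDerivAt_apply 0 w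
  have hπ1 : HasFDerivAt (fun q : Fin 2 → ℝ => q 1) (pr2 1) w := hasFDerivAt_apply 1 w
  rw [hasFDerivAt_pi']
  refine Fin.forall_fin_two.mpr ⟨?_, ?_⟩
  · have hfun : (fun q : Fin 2 → ℝ => chartB q 0) = fun q => 1 / 2 - moeb (q 1) := by
      funext q; simp [chartB]
    rw [hfun]
    refine (((hasDerivAt_moeb hw).comp_hasFDerivAt w hπ1).const_sub (1 / 2)).congr_fderiv
      (ContinuousLinearMap.ext fun v => ?_)
    simp [chartBDeriv]
  · have hfun : (fun q : Fin 2 → ℝ => chartB q 1) = fun q => q 0 := by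
      funext q; simp [chartB]
    rw [hfun]
    refine hπ0.congr_fderiv (ContinuousLinearMap.ext fun v => ?_)
    simp [chartBDeriv]

/-- `|det DΦ_B(w)| = 1/(1-u)²`. -/
theorem abs_det_chartBDeriv (w : Fin 2 → ℝ) : |(chartBDeriv w).det| = 1 / (1 - w 1) ^ 2 := by
  have hM : LinearMap.toMatrix' ((chartBDeriv w : (Fin 2 → ℝ) →L[ℝ] (Fin 2 → ℝ)) :
      (Fin 2 → ℝ) →ₗ[ℝ] (Fin 2 → ℝ)) = !![0, -(1 / (1 - w 1) ^ 2); 1, 0] := by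
    ext i j
    rw [LinearMap.toMatrix'_apply, ContinuousLinearMap.coe_coe]
    fin_cases i <;> fin_cases j <;> simp [chartBDeriv]
  rw [ContinuousLinearMap.det, ← LinearMap.det_toMatrix', hM, Matrix.det_fin_two_of,
    show (0 : ℝ) * 0 - -(1 / (1 - w 1) ^ 2) * 1 = 1 / (1 - w 1) ^ 2 by ring]
  exact abs_of_nonneg (by positivity)

/-- `Φ_B` is injective off `u = 1`. -/
theorem injOn_chartB : InjOn chartB {w | w 1 < 1} := by
  intro w hw w' hw' h
  have h0 := congrFun h 0
  have h1 := congrFun h 1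
  simp only [chartB, Matrix.cons_val_zero, Matrix.cons_val_one, sub_right_inj] at h0 h1
  funext i
  fin_cases i
  · exact h1
  · exact injOn_moeb hw hw' h0

/-- `Φ_B` is a `ℚ`-semialgebraic map on any semialgebraic set avoiding `u = 1`. -/
theorem isSemialgebraicMapOn_chartB {S : Set (Fin 2 → ℝ)} (hS : IsSemialgebraic ℚ S)
    (hS1 : ∀ w ∈ S, w 1 ≠ 1) : IsSemialgebraicMapOn ℚ S chartB := by
  refine IsSemialgebraicMapOn.of_forall hS fun i => ?_
  fin_cases i
  · refine (isSemialgebraicFunOn_aeval_div_aeval hS (1 - 3 * X 1) (2 - 2 * X 1)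
      fun w hw => ?_).congr fun w hw => ?_
    · have h1 := hS1 w hw
      simp only [map_sub, map_ofNat, map_mul, MvPolynomial.aeval_X]
      intro h; apply h1; linarith
    · have h1 : (1 : ℝ) - w 1 ≠ 0 := sub_ne_zero.mpr (hS1 w hw).symm
      have h2 : (2 : ℝ) - 2 * w 1 ≠ 0 := by intro h; apply h1; linarith
      show aeval w (1 - 3 * X 1 : MvPolynomial (Fin 2) ℚ) /
          aeval w (2 - 2 * X 1 : MvPolynomial (Fin 2) ℚ) = 1 / 2 - moeb (w 1)
      simp only [map_sub, map_one, map_ofNat, map_mul, MvPolynomial.aeval_X, moeb]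
      have h3 : w 1 / (1 - w 1) = 2 * w 1 / (2 - 2 * w 1) := by
        rw [div_eq_div_iff h1 h2]; ring
      rw [h3, div_eq_iff h2, sub_mul, div_mul_cancel₀ _ h2]
      ring
  · exact (isSemialgebraicFunOn_aeval hS (X 0)).congr fun w _ => by simp [chartB]

/-! ## The bands and the transported integrand -/

/-- The open band `(0,∞) × (0,1)` (`w 0 = y`, `w 1 = u`). -/
def openBandB : Set (Fin 2 → ℝ) := {w | 0 < w 0 ∧ 0 < w 1 ∧ w 1 < 1}

/-- The closed band `(0,∞) × [0,1]`. -/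
def bandB : Set (Fin 2 → ℝ) := {w | 0 < w 0 ∧ 0 ≤ w 1 ∧ w 1 ≤ 1}

/-- `openBandB ⊆ bandB`. -/
theorem openBandB_subset_bandB : openBandB ⊆ bandB := fun _ hw => ⟨hw.1, hw.2.1.le, hw.2.2.le⟩

/-- The open band is open. -/
theorem isOpen_openBandB : IsOpen openBandB :=
  (isOpen_lt continuous_const (continuous_apply 0)).inter
    ((isOpen_lt continuous_const (continuous_apply 1)).inter
      (isOpen_lt (continuous_apply 1) continuous_const))

/-- The open band is `ℚ`-semialgebraic. -/
theorem isSemialgebraic_openBandB : IsSemialgebraic ℚ openBandB := by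
  have h0 := isSemialgebraic_setOf_eval_pos (k := ℚ) (R := ℝ) (X 0 : MvPolynomial (Fin 2) ℚ)
  have h1 := isSemialgebraic_setOf_eval_pos (k := ℚ) (R := ℝ) (X 1 : MvPolynomial (Fin 2) ℚ)
  have h2 := isSemialgebraic_setOf_eval_pos (k := ℚ) (R := ℝ) (1 - X 1 : MvPolynomial (Fin 2) ℚ)
  refine (congrArg (IsSemialgebraic (R := ℝ) ℚ) ?_).mpr (h0.inter (h1.inter h2))
  ext w
  simp only [openBandB, mem_setOf_eq, mem_inter_iff, map_sub, map_one, MvPolynomial.aeval_X,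
    sub_pos]

/-- The closed band is `ℚ`-semialgebraic. -/
theorem isSemialgebraic_bandB : IsSemialgebraic ℚ bandB := by
  have h0 := isSemialgebraic_setOf_eval_pos (k := ℚ) (R := ℝ) (X 0 : MvPolynomial (Fin 2) ℚ)
  have h1 := isSemialgebraic_setOf_eval_nonneg (k := ℚ) (R := ℝ) (X 1 : MvPolynomial (Fin 2) ℚ)
  have h2 := isSemialgebraic_setOf_eval_nonneg (k := ℚ) (R := ℝ)
    (1 - X 1 : MvPolynomial (Fin 2) ℚ)
  refine (congrArg (IsSemialgebraic (R := ℝ) ℚ) ?_).mpr (h0.inter (h1.inter h2))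
  ext w
  simp only [bandB, mem_setOf_eq, mem_inter_iff, map_sub, map_one, MvPolynomial.aeval_X,
    sub_nonneg]

/-- The half-open band `(0,∞) × [0,1)` is `ℚ`-semialgebraic. -/
theorem isSemialgebraic_bandB₁ :
    IsSemialgebraic ℚ {w : Fin 2 → ℝ | 0 < w 0 ∧ 0 ≤ w 1 ∧ w 1 < 1} := by
  have h0 := isSemialgebraic_setOf_eval_pos (k := ℚ) (R := ℝ) (X 0 : MvPolynomial (Fin 2) ℚ)
  have h1 := isSemialgebraic_setOf_eval_nonneg (k := ℚ) (R := ℝ) (X 1 : MvPolynomial (Fin 2) ℚ)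
  have h2 := isSemialgebraic_setOf_eval_pos (k := ℚ) (R := ℝ) (1 - X 1 : MvPolynomial (Fin 2) ℚ)
  refine (congrArg (IsSemialgebraic (R := ℝ) ℚ) ?_).mpr (h0.inter (h1.inter h2))
  ext w
  simp only [mem_setOf_eq, mem_inter_iff, map_sub, map_one, MvPolynomial.aeval_X, sub_pos]

/-- The edge `(0,∞) × {1}` is `ℚ`-semialgebraic. -/
theorem isSemialgebraic_bandB₂ :
    IsSemialgebraic ℚ {w : Fin 2 → ℝ | 0 < w 0 ∧ 1 ≤ w 1 ∧ w 1 ≤ 1} := by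
  have h0 := isSemialgebraic_setOf_eval_pos (k := ℚ) (R := ℝ) (X 0 : MvPolynomial (Fin 2) ℚ)
  have h1 := isSemialgebraic_setOf_eval_nonneg (k := ℚ) (R := ℝ)
    (X 1 - 1 : MvPolynomial (Fin 2) ℚ)
  have h2 := isSemialgebraic_setOf_eval_nonneg (k := ℚ) (R := ℝ)
    (1 - X 1 : MvPolynomial (Fin 2) ℚ)
  refine (congrArg (IsSemialgebraic (R := ℝ) ℚ) ?_).mpr (h0.inter (h1.inter h2))
  ext w
  simp only [mem_setOf_eq, mem_inter_iff, map_sub, map_one, MvPolynomial.aeval_X, sub_nonneg]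

/-- `bandB` is the half-open band plus the edge `u = 1`. -/
theorem bandB_eq_union : bandB = {w : Fin 2 → ℝ | 0 < w 0 ∧ 0 ≤ w 1 ∧ w 1 < 1} ∪
    {w : Fin 2 → ℝ | 0 < w 0 ∧ 1 ≤ w 1 ∧ w 1 ≤ 1} := by
  ext w
  simp only [bandB, mem_setOf_eq, mem_union]
  constructor
  · rintro ⟨h0, h1, h2⟩
    rcases h2.lt_or_eq with h | h
    · exact Or.inl ⟨h0, h1, h⟩
    · exact Or.inr ⟨h0, h.ge, h2⟩
  · rintro (⟨h0, h1, h2⟩ | ⟨h0, h1, h2⟩)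
    · exact ⟨h0, h1, h2.le⟩
    · exact ⟨h0, by linarith, h2⟩

/-- `Φ_B` maps the half-open band into `Eup`. -/
theorem chartB_mapsTo : MapsTo chartB {w : Fin 2 → ℝ | 0 < w 0 ∧ 0 ≤ w 1 ∧ w 1 < 1} Eup := by
  intro w hw
  have hm := moeb_nonneg hw.2.1 hw.2.2
  refine ⟨?_, ?_, Or.inl ?_⟩
  · show 0 ≤ chartB w 1
    simp [chartB, hw.1.le]
  · show chartB w 0 ≤ 1 / 2
    simp [chartB, hm]
  · show 0 < chartB w 1
    simp [chartB, hw.1]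

/-- `Φ_B(openBandB) = D`. -/
theorem image_chartB : chartB '' openBandB = Dom := by
  refine Subset.antisymm (image_subset_iff.2 fun w hw => ?_) fun z hz => ?_
  · have hm := moeb_pos hw.2.1 hw.2.2
    refine ⟨?_, ?_⟩
    · show chartB w 0 < 1 / 2
      simp [chartB, hm]
    · show 0 < chartB w 1
      simp [chartB, hw.1]
  · have hy' : 0 < 1 / 2 - z 0 := by linarith [hz.1]
    refine ⟨![z 1, (1 / 2 - z 0) / (1 + (1 / 2 - z 0))],
      ⟨by simpa using hz.2, by simpa using div_pos hy' (by linarith),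
        by simpa using (div_lt_one (by linarith)).mpr (by linarith)⟩, ?_⟩
    have hm := moeb_div_one_add hy'.le
    funext i
    fin_cases i
    · simp only [chartB, Fin.zero_eta, Matrix.cons_val_zero, Matrix.cons_val_one,
        Matrix.cons_val_fin_one]
      rw [hm]
      ring
    · simp [chartB]

/-- The transported integrand `h_p(Φ_B(w)) |det DΦ_B(w)|`, extended by `0` to `u = 1`. -/
def fB (p : ℕ) (w : Fin 2 → ℝ) : ℝ := if w 1 < 1 then Hz p (chartB w) / (1 - w 1) ^ 2 else 0

/-- The primitive `Q_p(Φ_B(w))` along the fibres, extended by `0` to `u = 1`. -/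
def FB (p : ℕ) (w : Fin 2 → ℝ) : ℝ := if w 1 < 1 then Qz p (chartB w) else 0

/-- `fB` is `ℚ`-semialgebraic on the closed band. -/
theorem sa_fB (p : ℕ) : IsSemialgebraicFunOn ℚ bandB (fB p) := by
  have hne : ∀ w ∈ {w : Fin 2 → ℝ | 0 < w 0 ∧ 0 ≤ w 1 ∧ w 1 < 1}, w 1 ≠ 1 :=
    fun w hw => ne_of_lt hw.2.2
  have hf₁ : IsSemialgebraicFunOn ℚ {w : Fin 2 → ℝ | 0 < w 0 ∧ 0 ≤ w 1 ∧ w 1 < 1}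
      (fun w => Hz p (chartB w) / (1 - w 1) ^ 2) :=
    (((sa_Hz p).comp_isSemialgebraicMapOn_holds
      (isSemialgebraicMapOn_chartB isSemialgebraic_bandB₁ hne) chartB_mapsTo).fun_mul
      (isSemialgebraicFunOn_aeval_div_aeval isSemialgebraic_bandB₁ 1 ((1 - X 1) ^ 2)
        fun w hw => by simpa [sub_eq_zero] using pow_ne_zero 2 (sub_ne_zero.mpr (hne w hw).symm))).congr
      fun w _ => by simp only [Function.comp, map_one, map_pow, map_sub, MvPolynomial.aeval_X]; ring
  have hf₂ : IsSemialgebraicFunOn ℚ {w : Fin 2 → ℝ | 0 < w 0 ∧ 1 ≤ w 1 ∧ w 1 ≤ 1}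
      (fun _ => (0 : ℝ)) :=
    (isSemialgebraicFunOn_aeval isSemialgebraic_bandB₂ (0 : MvPolynomial (Fin 2) ℚ)).congr
      fun _ _ => by simp
  rw [bandB_eq_union]
  exact hf₁.union hf₂ (fun w hw => if_pos hw.2.2) (fun w hw => if_neg (not_lt.mpr hw.2.1))

/-- `FB` is `ℚ`-semialgebraic on the closed band. -/
theorem sa_FB (p : ℕ) : IsSemialgebraicFunOn ℚ bandB (FB p) := by
  have hne : ∀ w ∈ {w : Fin 2 → ℝ | 0 < w 0 ∧ 0 ≤ w 1 ∧ w 1 < 1}, w 1 ≠ 1 :=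
    fun w hw => ne_of_lt hw.2.2
  have hf₁ : IsSemialgebraicFunOn ℚ {w : Fin 2 → ℝ | 0 < w 0 ∧ 0 ≤ w 1 ∧ w 1 < 1}
      (fun w => Qz p (chartB w)) :=
    (sa_PQ p).2.comp_isSemialgebraicMapOn_holds
      (isSemialgebraicMapOn_chartB isSemialgebraic_bandB₁ hne) chartB_mapsTo
  have hf₂ : IsSemialgebraicFunOn ℚ {w : Fin 2 → ℝ | 0 < w 0 ∧ 1 ≤ w 1 ∧ w 1 ≤ 1}
      (fun _ => (0 : ℝ)) :=
    (isSemialgebraicFunOn_aeval isSemialgebraic_bandB₂ (0 : MvPolynomial (Fin 2) ℚ)).congr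
      fun _ _ => by simp
  rw [bandB_eq_union]
  exact hf₁.union hf₂ (fun w hw => if_pos hw.2.2) (fun w hw => if_neg (not_lt.mpr hw.2.1))

/-- `fB` is absolutely integrable on the open band (transport from `[D, h_p]`). -/
theorem integrableOn_fB (p : ℕ) (hp : p = 1 ∨ p = 2) : IntegrableOn (fB p) openBandB := by
  have h := (integrableOn_iff_of_chart (S := openBandB) (Φ := chartB) (Φ' := chartBDeriv)
    (J := fun w => 1 / (1 - w 1) ^ 2) (f := fB p) (g := Hz p) isOpen_openBandB.measurableSet
    (fun w hw => hasFDerivAt_chartB (ne_of_lt hw.2.2)) (injOn_chartB.mono fun w hw => hw.2.2)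
    (fun w _ => abs_det_chartBDeriv w) (fun w hw => by simp [fB, hw.2.2, div_eq_mul_inv])).mp
  rw [image_chartB] at h
  exact h (cauchyRep p hp).integrableOn

/-- The edges `u = 0`, `u = 1` of the band are null. -/
theorem volume_bandB_diff : volume (bandB \ openBandB) = 0 := by
  have hp : ∀ a : ℝ, volume {w : Fin 2 → ℝ | w 1 = a} = 0 := fun a => by
    rw [MeasureTheory.volume_pi]
    exact Measure.pi_hyperplane (fun _ => (volume : Measure ℝ)) 1 a
  refine measure_mono_null (fun w hw => ?_) (measure_union_null (hp 0) (hp 1))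
  obtain ⟨hB, hO⟩ := hw
  simp only [bandB, openBandB, mem_setOf_eq, not_and, not_lt] at hB hO
  simp only [mem_union, mem_setOf_eq]
  rcases hB.2.1.eq_or_lt with h | h
  · exact Or.inl h.symm
  · exact Or.inr (le_antisymm hB.2.2 (hO hB.1 h))

end SoloBlind

end Summit.KontsevichZagierPeriods.KontsevichZagierPeriods.Theorems
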